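import Summits.NavierStokesRegularity.NavierStokesRegularity.Theorems.UnthreadedDoorNetFluxTypeIVorticityBound
import Summits.NavierStokesRegularity.NavierStokesRegularity.Theorems.IsobarTomographyBlobRiccatiClosureTypeIGaugeBounds
import Literature.Analysis.FluidPDE.MildAncientTimeDecayRegularity
import HarnessLib

/-!
# Type-I velocity ⇒ Type-I Hessian for bounded ancient mild solutions
# (`TypeIHessianBound`, Λ-T′ of the crux idea «indicatrix-bound» on crux `PoloidalLiouville`, stmt-NavierStokesRegularity-1222)

Support file for crux `PoloidalLiouville` (wall W1; crux idea «indicatrix-bound» of planner ns-idea-14,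
`Cruxes/PoloidalLiouville/IndicatrixSketch.lean`, support Prop Λ-T′ `TypeIHessianBound`, registered stub
`stub_typeIHessianBound`).  Experiment cell `pub/ns-wall-extremal` (req171), seat ns-wall-eng-4 g7.  Theorems
only; no definitions, no named facts; nothing here proves `PoloidalLiouville`, `stub_scalarLiouville` or
Navier–Stokes regularity.

THE STATEMENT (body of the sketch's `TypeIHessianBound` VERBATIM, here
`PoloidalLiouville.Indicatrix.typeIHessianBound`): for a bounded ancient mild solution `v` of Navier–Stokes
(`ν = 1`, the tree's duality class `Literature.Analysis.FluidPDE.IsBoundedAncientMildSolution`) which is smooth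
on `(−∞,0) × ℝ³` and Type I in time, `‖v(t,x)‖ ≤ C/√(−t)` (`HasTypeITimeDecay C v`), there is `C₂` with
`‖D²v(t,·)(x)‖ ≤ C₂/√(−t)³` for all `t < 0`, `x` (Koch–Nadirashvili–Seregin–Šverák 2009, (1.4) with Prop. 4.1 /
(4.10), `k = 2`, and the scaling (1.2)).

THE PROOF (route (A) of the custodian's recipe; all inputs in the tree, cited by name).
1. Oseen gauge (`oseen_gauge_of_aestronglyMeasurable`, line `registered` of crux `TypeIliouvilleL`):
   `v(t) = w(t, · − A(t)) + c(t)` a.e., with `w` a bounded continuous Oseen-mild field; both sides are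
   continuous, so the identity holds everywhere.  Hence `‖w(σ,y) + c(σ)‖ ≤ C/√(−σ)`.
2. Momentum at spatial infinity pins the parasitic drift (`NetFlux.norm_drift_sub_le`, the NF-2 file):
   `‖c(t) − c(s)‖ ≤ C/√(−t) + C/√(−s)`.  So `(c(−n−1))ₙ` is Cauchy; its limit `c_∞` satisfies
   `‖c(σ) − c_∞‖ ≤ C/√(−σ)` for every `σ < 0`.
3. Constant Galilean boost by `c_∞` (`stub_oseen_const_boost`): `w_∞(σ,y) = w(σ, y − σ c_∞) + c_∞` is
   continuous, weakly divergence free and Oseen-mild on the whole past, and `‖w_∞(σ,y)‖ ≤ 2C/√(−σ)`: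
   `HasTypeITimeDecay (2C) w_∞`.
4. The time-only class is the KNSS-gauge class: `isTypeIAncientMild_of_hasTypeITimeDecay` gives
   `IsTypeIAncientMild (2C) w_∞` (KNSS Prop. 4.1).
5. The class-uniform scale-invariant Hessian bound
   `BlobRiccatiClosure.TypeIApexLiouville.typeIGauge_exists_norm_iteratedFDeriv_two_le (2C)` (KNSS (4.10) with
   `k = 2` and the scaling (1.2)): `(−t)√(−t)‖D²w_∞(t)(y)‖ ≤ K` with ONE `K = K(2C)` for every such field.
6. `v(t) = w_∞(t, · + d_t) + (c(t) − c_∞)` with `d_t = t c_∞ − A(t)`: the translation commutes with `D²`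
   (`iteratedFDeriv_comp_add_right`) and the additive constant is killed by `D²`, whence
   `‖D²v(t)(x)‖ ≤ K/√(−t)³`.

## References
* G. Koch, N. Nadirashvili, G. Seregin, V. Šverák, Acta Math. 203 (2009) 83–105 = arXiv:0709.3599, §1 (1.2), (1.4),
  §4 Prop. 4.1 with (4.10), §6. [KochNadirashviliSereginSverak2009]
* planner ns-idea-14, `Cruxes/PoloidalLiouville/IndicatrixSketch.lean` (Λ-T′); `pub/ns-wall-extremal/STATUS.md`.
-/

-- the summit and its single problem share the name (D-0017 nested layout)
set_option linter.dupNamespace false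

noncomputable section

namespace Summit.NavierStokesRegularity.NavierStokesRegularity.Theorems

open MeasureTheory Filter Set Function Metric
open scoped Topology
open Literature.Analysis Literature.Analysis.FluidPDE Literature.Analysis.UnboundedOperators

namespace PoloidalLiouville.Indicatrix

/-- **Type-I velocity ⇒ Type-I Hessian** (the body of the indicatrix card's `TypeIHessianBound`, Λ-T′,
VERBATIM): a bounded ancient mild solution of Navier–Stokes (`ν = 1`, duality class) which is smooth on
`(−∞,0) × ℝ³` and satisfies `‖v(t,x)‖ ≤ C/√(−t)` has `‖D²v(t,·)(x)‖ ≤ C₂/√(−t)³` for one constant `C₂` and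
all `t < 0`, `x`.  Here `C₂ = K(2C)` is the class-uniform gauge Hessian constant of
`typeIGauge_exists_norm_iteratedFDeriv_two_le` (KNSS 2009 (4.10), `k = 2`, transported by the scaling (1.2)),
reached through the Oseen gauge, the momentum-at-infinity drift estimate and the constant boost by the limit
drift `c_∞` (module docstring).
[cite: KochNadirashviliSereginSverak2009, (1.2), (1.4), Prop. 4.1 with (4.10), §6 (arXiv:0709.3599v1 pp. 2, 8, 12)] -/
theorem typeIHessianBound :
    ∀ (v : ℝ → EuclideanSpace ℝ (Fin 3) → EuclideanSpace ℝ (Fin 3)) (C : ℝ),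
      IsBoundedAncientMildSolution 1 v → HasTypeITimeDecay C v →
      ContDiffOn ℝ (⊤ : ℕ∞) (uncurry v) (Iio 0 ×ˢ univ) →
      ∃ C₂ : ℝ, ∀ t < 0, ∀ x, ‖iteratedFDeriv ℝ 2 (v t) x‖ ≤ C₂ / Real.sqrt (-t) ^ 3 := by
  intro u C hB hT hsm
  -- ### Step 0: slices are continuous, hence a.e.-strongly measurable; `0 ≤ C`
  have huc : ∀ t < 0, Continuous (u t) := fun t ht =>
    hsm.continuousOn.comp_continuous (continuous_const.prodMk continuous_id) fun y =>
      mk_mem_prod (mem_Iio.2 ht) (mem_univ y)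
  have hmeas : ∀ t < 0, AEStronglyMeasurable (u t) volume := fun t ht =>
    (huc t ht).aestronglyMeasurable
  have hC : 0 ≤ C := by
    have h := hT (-1) (by norm_num) 0
    rw [neg_neg, Real.sqrt_one, div_one] at h
    exact (norm_nonneg _).trans h
  -- ### Step 1: the Oseen gauge, everywhere
  obtain ⟨w, A, c, hwm, hwc, ⟨K, hK⟩, hwd, hwmild, -, hrep⟩ :=
    oseen_gauge_of_aestronglyMeasurable u hB hmeas
  have hwsl : ∀ σ < 0, Continuous (w σ) := fun σ hσ =>
    hwc.comp_continuous (continuous_const.prodMk continuous_id) fun y =>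
      mk_mem_prod (mem_Iio.2 hσ) (mem_univ y)
  have hrep' : ∀ t < 0, u t = fun x => w t (x - A t) + c t := fun t ht =>
    (Continuous.ae_eq_iff_eq volume (huc t ht)
      (((hwsl t ht).comp (continuous_id.sub continuous_const)).add continuous_const)).1 (hrep t ht)
  -- the gauge field is `C/√(−σ)`-close to the constant `−c(σ)`
  have hclose : ∀ σ < 0, ∀ y, ‖w σ y + c σ‖ ≤ C / Real.sqrt (-σ) := by
    intro σ hσ y
    have h := congrFun (hrep' σ hσ) (y + A σ)
    simp only [add_sub_cancel_right] at h
    rw [← h]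
    exact hT σ hσ _
  -- ### Step 2: momentum at infinity pins the drift
  have hdrift : ∀ s t : ℝ, s < t → t < 0 →
      ‖c t - c s‖ ≤ C / Real.sqrt (-t) + C / Real.sqrt (-s) := fun s t hst ht =>
    NetFlux.norm_drift_sub_le hwm hK hwmild hclose hst ht
  -- ### Step 3: the limit drift `c_∞ = lim_{n → ∞} c(−n−1)`
  have hsq : ∀ n : ℕ, 0 < Real.sqrt ((n : ℝ) + 1) := fun n => Real.sqrt_pos.2 (by positivity)
  have hcs : CauchySeq (fun n : ℕ => c (-((n : ℝ) + 1))) := by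
    refine cauchySeq_of_le_tendsto_0' (fun n : ℕ => 2 * C / Real.sqrt ((n : ℝ) + 1)) ?_ ?_
    · intro n m hnm
      rw [dist_eq_norm]
      rcases hnm.eq_or_lt with heq | hlt
      · rw [heq, sub_self, norm_zero]
        exact div_nonneg (by linarith) (hsq m).le
      · have hmn : -((m : ℝ) + 1) < -((n : ℝ) + 1) := by
          have : (n : ℝ) < m := by exact_mod_cast hlt
          linarith
        have h := hdrift (-((m : ℝ) + 1)) (-((n : ℝ) + 1)) hmn (by linarith)
        rw [neg_neg, neg_neg] at h
        have hle : C / Real.sqrt ((m : ℝ) + 1) ≤ C / Real.sqrt ((n : ℝ) + 1) :=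
          div_le_div_of_nonneg_left hC (hsq n)
            (Real.sqrt_le_sqrt (by
              have hnm' : (n : ℝ) ≤ m := by exact_mod_cast hnm
              linarith))
        calc ‖c (-((n : ℝ) + 1)) - c (-((m : ℝ) + 1))‖
            ≤ C / Real.sqrt ((n : ℝ) + 1) + C / Real.sqrt ((m : ℝ) + 1) := h
          _ ≤ C / Real.sqrt ((n : ℝ) + 1) + C / Real.sqrt ((n : ℝ) + 1) := by gcongr
          _ = 2 * C / Real.sqrt ((n : ℝ) + 1) := by ring
    · have hg : Tendsto (fun n : ℕ => Real.sqrt ((n : ℝ) + 1)) atTop atTop :=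
        Real.tendsto_sqrt_atTop.comp
          (tendsto_atTop_add_const_right _ _ tendsto_natCast_atTop_atTop)
      exact tendsto_const_nhds.div_atTop hg
  obtain ⟨cinf, hcinf⟩ := cauchySeq_tendsto_of_complete hcs
  have hcinf' : ∀ σ < 0, ‖c σ - cinf‖ ≤ C / Real.sqrt (-σ) := by
    intro σ hσ
    have hlim : Tendsto (fun n : ℕ => ‖c σ - c (-((n : ℝ) + 1))‖) atTop (𝓝 ‖c σ - cinf‖) :=
      (tendsto_const_nhds.sub hcinf).norm
    have hg : Tendsto (fun n : ℕ => Real.sqrt ((n : ℝ) + 1)) atTop atTop :=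
      Real.tendsto_sqrt_atTop.comp
        (tendsto_atTop_add_const_right _ _ tendsto_natCast_atTop_atTop)
    have hbd : Tendsto (fun n : ℕ => C / Real.sqrt (-σ) + C / Real.sqrt ((n : ℝ) + 1)) atTop
        (𝓝 (C / Real.sqrt (-σ) + 0)) :=
      tendsto_const_nhds.add (tendsto_const_nhds.div_atTop hg)
    rw [add_zero] at hbd
    refine le_of_tendsto_of_tendsto hlim hbd ?_
    refine Filter.eventually_atTop.2 ⟨⌈-σ⌉₊, fun n hn => ?_⟩
    have hnσ : -((n : ℝ) + 1) < σ := by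
      have h1 : -σ ≤ (⌈-σ⌉₊ : ℝ) := Nat.le_ceil _
      have h2 : (⌈-σ⌉₊ : ℝ) ≤ n := by exact_mod_cast hn
      linarith
    have h := hdrift (-((n : ℝ) + 1)) σ hnσ hσ
    rwa [neg_neg] at h
  -- ### Step 4: the constant boost by `c_∞` is Type I on the whole past
  obtain ⟨hbc, -, hbd, hbmild⟩ := stub_oseen_const_boost w (-cinf) hwc ⟨K, hK⟩ hwd hwmild
  set wb : ℝ → EuclideanSpace ℝ (Fin 3) → EuclideanSpace ℝ (Fin 3) :=
    fun σ y => w σ (y + σ • -cinf) - -cinf with hwb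
  have hTb : HasTypeITimeDecay (2 * C) wb := by
    intro σ hσ y
    have hval : wb σ y = (w σ (y + σ • -cinf) + c σ) + (cinf - c σ) := by
      simp only [hwb]; abel
    rw [hval]
    calc ‖(w σ (y + σ • -cinf) + c σ) + (cinf - c σ)‖
        ≤ ‖w σ (y + σ • -cinf) + c σ‖ + ‖cinf - c σ‖ := norm_add_le _ _
      _ ≤ C / Real.sqrt (-σ) + C / Real.sqrt (-σ) := by
          refine add_le_add (hclose σ hσ _) ?_
          rw [norm_sub_rev]
          exact hcinf' σ hσ
      _ = 2 * C / Real.sqrt (-σ) := by ring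
  -- ### Step 5: the boosted gauge field is in the KNSS class `IsTypeIAncientMild (2C)`
  have hclass : IsTypeIAncientMild (2 * C) wb :=
    isTypeIAncientMild_of_hasTypeITimeDecay hTb hbc hbmild hbd
  -- ### Step 6: the class-uniform scale-invariant Hessian bound
  obtain ⟨K₂, hK₂⟩ := BlobRiccatiClosure.TypeIApexLiouville.typeIGauge_exists_norm_iteratedFDeriv_two_le (2 * C)
  refine ⟨K₂, fun t ht x => ?_⟩
  have ht0 : 0 < -t := by linarith
  have hst : 0 < Real.sqrt (-t) := Real.sqrt_pos.2 ht0
  have hpos : 0 < (-t) * Real.sqrt (-t) := mul_pos ht0 hst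
  -- ### Step 7: `u t` is a translate of `wb t` plus a constant
  set d : EuclideanSpace ℝ (Fin 3) := t • cinf - A t with hd
  have hut : u t = (fun x => wb t (x + d)) + fun _ => c t - cinf := by
    rw [hrep' t ht]
    funext x
    have hx : x + d + t • -cinf = x - A t := by
      rw [hd, smul_neg]; abel
    simp only [Pi.add_apply, hwb, hx]
    abel
  have hsl : ContDiff ℝ 2 (wb t) := contDiff_infty.1 (hclass.contDiff_slice ht) 2
  have htr : ContDiff ℝ 2 (fun x => wb t (x + d)) := hsl.comp (contDiff_id.add contDiff_const)
  have hD : iteratedFDeriv ℝ 2 (u t) x = iteratedFDeriv ℝ 2 (wb t) (x + d) := by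
    rw [hut, iteratedFDeriv_add_apply htr.contDiffAt contDiff_const.contDiffAt,
      iteratedFDeriv_const_of_ne (by norm_num) _, Pi.zero_apply, add_zero,
      iteratedFDeriv_comp_add_right]
  have hgauge : ‖iteratedFDeriv ℝ 2 (wb t) (x + d)‖ ≤ K₂ / ((-t) * Real.sqrt (-t)) := by
    rw [le_div_iff₀ hpos, mul_comm]
    exact hK₂ hclass t ht (x + d)
  have h3 : Real.sqrt (-t) ^ 3 = (-t) * Real.sqrt (-t) := by
    rw [pow_succ, Real.sq_sqrt ht0.le]
  rw [hD, h3]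
  exact hgauge

end PoloidalLiouville.Indicatrix

end Summit.NavierStokesRegularity.NavierStokesRegularity.Theorems

end
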